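import Summits.CriticalPhenomena.CardyFormulaZ2.Theorems.CardyIKTransportIKLinearTransportLine
import Summits.CriticalPhenomena.CardyFormulaZ2.Theorems.CardyIKTransportIKMixedBoxCrossingStubPatternLocality

/-!
# `stub_LinearTransport` (crux stmt-CriticalPhenomena-5076, line `pinned-diagram-exchange`) — RESHAPE,
# part 1 of 4: transport vocabulary and the column-strip Markov property `stripLaw`

Support file (`--supports stmt-CriticalPhenomena-5076`, registered sub-goal `stripLaw`). The registered stub

  `stub_LinearTransport : (∃ C c, 0 < c ∧ ∀ S i, (i ∈ S ↔ i+1 ∉ S) → ∃ T, IsExchangeKernel C c S i T) →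
     (∃ c, 0 < c ∧ ∀ S n, 1 ≤ n → ∀ a b E, MeasurableSet E → CondRSWBound c S n a b E) →
     ∃ K₁, IsTransportCoupling K₁`

(Manolescu, arXiv:2502.08394, Thm 5.4 / §5.3, re-run with the pinned exchange maps of this line) is cut into
three pieces over the line's vocabulary, with a SORRY-FREE composition (`linearTransport_of_parts` in the
sibling file `…TransportGlue`):

* S₁ `stripLaw` (THIS FILE, proved): the COLUMN-STRIP MARKOV PROPERTY of the gauge — the law of the
  observables on the cell/face columns `[a, b]` under `ν_S` depends on `S ∩ [a, b]` only (the IK analogue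
  of Manolescu's Cor. 5.16, which §5.3.1/§5.3.6 use to identify the window laws at the two ends of the
  exchange chain). Proof: re-anchor the gauge at column `a` (landed `StubPatternLocality.exists_lift_hshift`)
  and origin pattern locality (`mem_blackSet_congr` / `mem_antiSet_congr`).
* S₂ `windowTransport` (OPEN — the research core, Manolescu §5.3.2–§5.3.6: exchange chain, stability of
  mesoscopic clusters, nails/homotopy → shadowing; NOT in these files): the OBSERVABLE-LEVEL FINITE-BLOCK
  TRANSPORT — a real-linear `K₁` such that for all `ε, ρ, A > 0` and all small meshes `δ` some pattern `S₀`
  isotropic on the block `|j| ≤ ⌈A/δ⌉` and some pattern `S₁` honeycomb there admit a coupling `π` of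
  `ν_{S₀}` with `ν_{S₁}` under which `badObs K₁ δ ε ρ` has mass `≤ ε`. Its statement enters the compositions
  of `…TransportGlue` as a HYPOTHESIS only.
* S₃ `couplingLift` (sibling files `…CouplingLift`, `…CouplingLift2`, proved): lift of an observable coupling
  of two block patterns with the right window laws to a coupling of `μIK` with `μIK` dominating `badPair`.

This file: the vocabulary of the reshape — the column strip `colStrip`, the observable-level bad event
`badObs` (with `badPair = (obs univ, obs ∅)⁻¹' badObs`, definitional), and the two hypothesis SHAPES
`FarRSWBound` / `RatioMixBound` of the FKG-free-explicit variant of S₂ (Manolescu's (RSW) Thm 5.7 at all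
aspect ratios with black rings, and the ratio form of the mixing property Prop. 5.9) —, the re-anchoring
helpers `StripLaw.*`, and `stripLaw`.
-/

noncomputable section

namespace Summit.CriticalPhenomena.CardyFormulaZ2.Theorems.IKLinearTransport.PinnedDiagramExchange

open scoped BigOperators Topology Classical MeasureTheory ProbabilityTheory ENNReal
open Filter Set Function MeasureTheory
open Literature.Probability.Percolation Literature.Probability.LatticeModels
open Literature.Probability.RandomPlanarGeometry

/-! ## §0 Vocabulary of the reshape -/

/-- The cells and faces of the columns `a … b`. [folklore] -/
def colStrip (a b : ℤ) : Set (Site 2) := {v | a ≤ v 0 ∧ v 0 ≤ b}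

/-- The BAD EVENT AT THE LEVEL OF OBSERVABLES: `badPair K δ ε ρ` with the two observable configurations
`(obs univ ω, obs ∅ ω')` replaced by a pair `(x, x')` of observable configurations (so that
`badPair K δ ε ρ` is its preimage, `badPair_eq_preimage_badObs`). [folklore] -/
def badObs (K : ℂ ≃L[ℝ] ℂ) (δ ε ρ : ℝ) : Set (Obs × Obs) :=
  {xx' | ∃ b : Bool,
    (∃ p ∈ monoPaths xx'.1 b, (∀ v ∈ p, ‖pos δ v‖ ≤ ρ) ∧
      (∃ v ∈ p, ∃ w ∈ p, ε ≤ ‖pos δ v - pos δ w‖) ∧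
      ∀ p' ∈ monoPaths xx'.2 b, p' ∉ shadows K δ ε p) ∨
    (∃ p' ∈ monoPaths xx'.2 b, (∀ v ∈ p', ‖pos δ v‖ ≤ ρ) ∧
      (∃ v ∈ p', ∃ w ∈ p', ε ≤ ‖pos δ v - pos δ w‖) ∧
      ∀ p ∈ monoPaths xx'.1 b, p ∉ shadows K.symm δ ε p')}

/-- `badPair` is the preimage of `badObs` under `(obs univ, obs ∅)` (definitional). [folklore] -/
theorem badPair_eq_preimage_badObs (K : ℂ ≃L[ℝ] ℂ) (δ ε ρ : ℝ) :
    badPair K δ ε ρ = (fun ωω' : Ω × Ω => (obs Set.univ ωω'.1, obs ∅ ωω'.2)) ⁻¹' badObs K δ ε ρ :=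
  rfl

/-- FAR-CONDITIONED RSW BOUND for the `w × h` box at `(a, b)` with conditioning distance `n`
(Manolescu's (RSW), arXiv:2502.08394 Thm 5.7, in the line's vocabulary; the registered `CondRSWBound c S n a b E`
is the pair of instances `(w, h) = (2n, n)` [left–right] and `(n, 2n)` [bottom–top]): if `E` is determined
by the cells at sup-distance `≥ n` from the box, then given `E` the box is crossed by black paths in
both directions and is surrounded by a BLACK RING inside its `n`-neighbourhood (dual form: no white path
from the box reaches sup-distance `≥ n`), each with `ν_S`-probability `≥ c`.  A hypothesis SHAPE of
the reshaped stub (the route posits it; not a literature fact). [folklore] -/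
def FarRSWBound (c : ℝ) (S : Set ℤ) (n : ℕ) (a b : ℤ) (w h : ℕ) (E : Set Obs) : Prop :=
  E ∈ determinedOn (farFrom a b w h n) →
    c * (νmix S).real E ≤ (νmix S).real (E ∩ lrCross a b w h) ∧
    c * (νmix S).real E ≤ (νmix S).real (E ∩ tbCross a b w h) ∧
    c * (νmix S).real E ≤ (νmix S).real (E ∩ {x | ∀ p ∈ monoPaths x false,
      (∃ u ∈ p, a ≤ u 0 ∧ u 0 < a + w ∧ b ≤ u 1 ∧ u 1 < b + h) → ∀ v ∈ p, v ∉ farFrom a b w h n})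

/-- RATIO (density) form of the mixing property (Manolescu Prop. 5.9; the density form of the lead's
screening lemma `stub_Screening`, whose registered error term is `η · ν(E)`): for `E` determined at
sup-distance `≥ n` from the `w × h` box and `L` determined by the box,
`|ν(E ∩ L) − ν(E) ν(L)| ≤ η ν(E) ν(L)`.  A hypothesis SHAPE of the reshaped stub. [folklore] -/
def RatioMixBound (η : ℝ) (S : Set ℤ) (n : ℕ) (a b : ℤ) (w h : ℕ) (E L : Set Obs) : Prop :=
  E ∈ determinedOn (farFrom a b w h n) →
    L ∈ determinedOn {v : Site 2 | a ≤ v 0 ∧ v 0 < a + w ∧ b ≤ v 1 ∧ v 1 < b + h} →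
      |(νmix S).real (E ∩ L) - (νmix S).real E * (νmix S).real L| ≤
        η * ((νmix S).real E * (νmix S).real L)

/-! ## §0b Helpers for the strip law: shifts of observables and re-anchoring -/

namespace StripLaw

open Summit.CriticalPhenomena.CardyFormulaZ2.Cruxes.IKMixedBoxCrossing.PairedMirrorExploration
  (StubPatternLocality.shiftObs StubPatternLocality.exists_lift_hshift
    StubPatternLocality.mem_blackSet_congr StubPatternLocality.mem_antiSet_congr)

/-- Local name for the r4-line shift of observables. [folklore] -/
abbrev shiftObs (t : Site 2) (x : Obs) : Obs := StubPatternLocality.shiftObs t x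

/-- The shift of observables is measurable. [folklore] -/
theorem measurable_shiftObs (t : Site 2) : Measurable (shiftObs t) := by
  refine (measurable_set_iff.2 fun v => ?_).prodMk (measurable_set_iff.2 fun v => ?_)
  · exact (measurable_set_mem (v - t)).comp measurable_fst
  · exact (measurable_set_mem (v - t)).comp measurable_snd

/-- Shifting by `t` and then by `-t`… concretely: `shiftObs ![a,0] (shiftObs ![-a,0] x) = x`. [folklore] -/
theorem shiftObs_shiftObs_neg (a : ℤ) (x : Obs) : shiftObs ![a, 0] (shiftObs ![-a, 0] x) = x := by
  have key : ∀ v : Site 2, v - ![a, 0] - ![-a, 0] = v := fun v => by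
    ext i
    fin_cases i
    · simp only [Pi.sub_apply, Fin.zero_eta, Fin.isValue, Matrix.cons_val_zero, sub_neg_eq_add,
        sub_add_cancel]
    · simp only [Pi.sub_apply, Fin.mk_one, Fin.isValue, Matrix.cons_val_one, Matrix.cons_val_zero,
        sub_zero]
  refine Prod.ext (Set.ext fun v => ?_) (Set.ext fun v => ?_) <;>
    simp only [shiftObs, StubPatternLocality.shiftObs, Set.mem_preimage, key]

/-- RE-ANCHORING AT THE COLUMN `a`: the `ν_S`-probability of a measurable event `E` is the
`μIK`-probability that the observables of the shifted pattern `{x | x + a ∈ S}` lie in the event read `a`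
columns to the left (landed `exists_lift_hshift`). [folklore] -/
theorem nuMix_eq_reanchor (S : Set ℤ) (a : ℤ) {E : Set Obs} (hE : MeasurableSet E) :
    νmix S E = μIK (obs {x : ℤ | x + a ∈ S} ⁻¹' {y | shiftObs ![a, 0] y ∈ E}) := by
  obtain ⟨Φ, hΦ, hobs⟩ := StubPatternLocality.exists_lift_hshift S (-a)
  simp only [sub_neg_eq_add] at hobs
  have hE'm : MeasurableSet {y : Obs | shiftObs ![a, 0] y ∈ E} := (measurable_shiftObs ![a, 0]) hE
  rw [νmix, Measure.map_apply (CouplingToLimits.measurable_obs S) hE]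
  have hset : obs S ⁻¹' E = Φ ⁻¹' (obs {x : ℤ | x + a ∈ S} ⁻¹' {y | shiftObs ![a, 0] y ∈ E}) := by
    ext ω
    simp only [Set.mem_preimage, Set.mem_setOf_eq, hobs, shiftObs, shiftObs_shiftObs_neg]
  rw [hset, hΦ.measure_preimage
    ((CouplingToLimits.measurable_obs _ hE'm).nullMeasurableSet)]

/-- Origin pattern locality for colours (re-export of the r4-line lemma). [folklore] -/
theorem mem_blackSet_congr' {T T' : Set ℤ} {w : ℕ} (hT : ∀ i : ℕ, i < w → ((i : ℤ) ∈ T ↔ (i : ℤ) ∈ T'))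
    (ω : Ω) {v : Site 2} (h0 : 0 ≤ v 0) (hw : v 0 < w) : v ∈ blackSet T ω ↔ v ∈ blackSet T' ω :=
  StubPatternLocality.mem_blackSet_congr hT ω h0 hw

/-- Origin pattern locality for diagonal flags (re-export of the r4-line lemma). [folklore] -/
theorem mem_antiSet_congr' {T T' : Set ℤ} {w : ℕ} (hT : ∀ i : ℕ, i < w → ((i : ℤ) ∈ T ↔ (i : ℤ) ∈ T'))
    (ω : Ω) {f : Site 2} (h0 : 0 ≤ f 0) (hw : f 0 < w) : f ∈ antiSet T ω ↔ f ∈ antiSet T' ω :=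
  StubPatternLocality.mem_antiSet_congr hT ω h0 hw

end StripLaw

/-! ## §1 Piece S₁ — the column-strip Markov property of the gauge -/

/-- PIECE S₁ · `stripLaw` (PROVED) — THE COLUMN-STRIP MARKOV PROPERTY OF THE GAUGE (IK analogue of
Manolescu's Cor. 5.16): if two column patterns agree on `[a, b]`, every measurable event determined by
the cells and faces of the columns `a … b` has the same probability under `ν_S` and `ν_{S'}`.
Re-anchor the gauge at column `a` with the landed `μIK`-preserving lift
`StubPatternLocality.exists_lift_hshift`, then origin pattern locality pointwise. [folklore] -/
theorem stripLaw :
    ∀ (S S' : Set ℤ) (a b : ℤ), (∀ j : ℤ, a ≤ j → j ≤ b → (j ∈ S ↔ j ∈ S')) →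
      ∀ E : Set Obs, MeasurableSet E → E ∈ determinedOn (colStrip a b) → νmix S E = νmix S' E := by
  intro S S' a b hagree E hE hdet
  -- the event read `a` columns to the left, and its determining strip
  set E' : Set Obs := {y | StripLaw.shiftObs ![a, 0] y ∈ E} with hE'
  have hE'm : MeasurableSet E' := (StripLaw.measurable_shiftObs ![a, 0]) hE
  have hdet' : E' ∈ determinedOn (colStrip 0 (b - a)) := by
    intro y y' hyy'
    refine hdet _ _ fun v hv => ?_
    have hv' : v - ![a, 0] ∈ colStrip 0 (b - a) := by
      simp only [colStrip, Set.mem_setOf_eq, Pi.sub_apply, Matrix.cons_val_zero] at hv ⊢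
      omega
    exact hyy' (v - ![a, 0]) hv'
  -- both sides re-anchored at the column `a`
  rw [StripLaw.nuMix_eq_reanchor S a hE, StripLaw.nuMix_eq_reanchor S' a hE]
  -- origin pattern locality, pointwise
  congr 1
  refine Set.ext fun ω => ?_
  simp only [Set.mem_preimage]
  refine hdet' _ _ fun v hv => ?_
  have hv0 : 0 ≤ v 0 := hv.1
  have hvw : v 0 < ((b - a + 1).toNat : ℕ) := by
    have := hv.2
    omega
  have hT : ∀ i : ℕ, i < (b - a + 1).toNat →
      ((i : ℤ) ∈ {x : ℤ | x + a ∈ S} ↔ (i : ℤ) ∈ {x : ℤ | x + a ∈ S'}) := fun i hi => by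
    simp only [Set.mem_setOf_eq]
    exact hagree _ (by omega) (by omega)
  exact ⟨StripLaw.mem_blackSet_congr' hT ω hv0 hvw, StripLaw.mem_antiSet_congr' hT ω hv0 hvw⟩

end Summit.CriticalPhenomena.CardyFormulaZ2.Theorems.IKLinearTransport.PinnedDiagramExchange

end
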